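import Literature.InformationTheory.QuantumCodes.ConcatenationHierarchicalDecoding
import HarnessLib

/-!
# The level-`k` Steane sector code and its hierarchical decoder: the residual is a stabilizer iff no logical flip survives

Topic `Literature/InformationTheory/QuantumCodes` (continues `ConcatenationHierarchicalDecoding.lean`). There the recursive decoder is
summarised by its LOGICAL OUTPUT `AGP06.logicalFlip steaneSector k x`. This file spells out, for one sector (bit flips) of the `k`-fold
concatenated Steane code on the `7^k` qubits indexed by words `Fin k → Fin 7`, the three objects the threshold statement is about and
proves that they fit together:

* the CODE, recursively (Gottesman 1997 §3.5: the stabilizer of the concatenated code is generated by the inner stabilizers on each block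
  and the outer stabilizers written in the inner logical operators; Steane's `X̄ = X^{⊗7}`, `Z̄ = Z^{⊗7}`): `logical k x` (the logical class
  `⟨x, Z̄_k⟩` of a bit-flip pattern = the parity of its `7` sub-block classes), `IsNorm k x` (all `Z`-checks vanish: every sub-block is in
  the level-`(k-1)` normaliser and the Hamming syndrome of the sub-block classes is `0`), `IsStab k x := IsNorm k x ∧ logical k x = false`;
* the DECODER as an explicit correction (AGP06 §3.2, the recursive ideal decoder): `corr k x` = the inner corrections on every sub-block,
  then the logical `X̄_{k-1} = ` all-ones pattern on the sub-block named by the outer Hamming syndrome; `res k x = x + corr k x`;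
* **`isNorm_res`** (decoding always returns to the normaliser), **`logical_res`** (`logical k (res k x) = logicalFlip steaneSector k x`),
  hence **`isStab_res_iff`**: the residual error after hierarchical decoding is a STABILIZER (decoding succeeded) iff
  `logicalFlip steaneSector k x = false` — so the failure probability of this decoder on this code under independent bit flips is
  literally `AGP06.flipProb steaneSector p k ≤ (1/21)(21p)^{2^k}` (**`failProb_eq_flipProb`**, `failProb_le`).

The finitely many facts about the `[7,4,3]` Hamming checks that the inductions use (syndrome additivity, `X̄ = 1111111` has zero
syndrome, flipping the position named by the syndrome clears it, parity is additive) are checked by `decide`.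

## References

* [Gottesman1997] D. Gottesman, PhD thesis, arXiv:quant-ph/9705052, §3.5 (stabilizer of a concatenated code).
* [AliferisGottesmanPreskill2006] P. Aliferis, D. Gottesman, J. Preskill, Quantum Inf. Comput. 6 (2006) 97–165, §3.2 (recursive ideal
  decoder), §7 (Steane's [[7,1,3]] code).
-/

noncomputable section

open Finset
open scoped BigOperators

namespace Literature.InformationTheory.QuantumCodes

namespace AGP06

namespace SteaneSector

/-! ### Parity and syndrome on seven positions (all facts by `decide`) -/

/-- The parity (XOR) of seven bits. [cite: AliferisGottesmanPreskill2006, §7] -/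
def par7 (c : Fin 7 → Bool) : Bool := c 0 ^^ c 1 ^^ c 2 ^^ c 3 ^^ c 4 ^^ c 5 ^^ c 6

/-- Parity is additive (XOR is associative and commutative). [cite: AliferisGottesmanPreskill2006, §7] -/
theorem par7_xor (a b : Fin 7 → Bool) : par7 (fun i => a i ^^ b i) = (par7 a ^^ par7 b) := by
  simp only [par7]
  cases a 0 <;> cases a 1 <;> cases a 2 <;> cases a 3 <;> cases a 4 <;> cases a 5 <;> cases a 6 <;> simp

/-- The all-ones word has odd parity (`7` is odd): `X̄ = X^{⊗7}` is a logical operator. [cite: AliferisGottesmanPreskill2006, §7] -/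
theorem par7_allOnes : par7 (fun _ => true) = true := by decide

set_option maxRecDepth 8192 in
/-- The Hamming syndrome is additive as a `3`-bit word: patterns of zero syndrome are closed under XOR.
[cite: AliferisGottesmanPreskill2006, §7] -/
theorem hammingSyndrome_xor_eq_zero (a b : Fin 7 → Bool) (ha : hammingSyndrome a = 0) (hb : hammingSyndrome b = 0) :
    hammingSyndrome (fun i => a i ^^ b i) = 0 := by
  revert a b ha hb; unfold hammingSyndrome; decide +kernel

/-- The all-ones word has zero Hamming syndrome (each check has four positions). [cite: AliferisGottesmanPreskill2006, §7] -/
theorem hammingSyndrome_allOnes : hammingSyndrome (fun _ : Fin 7 => true) = 0 := by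
  unfold hammingSyndrome; decide

set_option maxRecDepth 8192 in
/-- Flipping the position named by the syndrome clears the syndrome (Hamming decoding returns to the code), for EVERY pattern.
[cite: AliferisGottesmanPreskill2006, §7] -/
theorem hammingSyndrome_correct (c : Fin 7 → Bool) :
    hammingSyndrome (fun i => c i ^^ decide (i.val + 1 = hammingSyndrome c)) = 0 := by
  revert c; unfold hammingSyndrome; decide +kernel

set_option maxRecDepth 8192 in
/-- `steaneSector` is the parity of the corrected pattern. [cite: AliferisGottesmanPreskill2006, §7] -/
theorem steaneSector_eq_par7 (c : Fin 7 → Bool) :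
    steaneSector c = par7 (fun i => c i ^^ decide (i.val + 1 = hammingSyndrome c)) := by
  revert c; unfold steaneSector hammingSyndrome par7; decide +kernel

/-! ### The level-`k` Steane sector code, recursively -/

/-- **The logical class** `⟨x, Z̄_k⟩` of a bit-flip pattern on the level-`k` block (`Z̄_k = Z^{⊗7^k}`): at level `0` the bit itself; at
level `k+1` the parity of the seven sub-block classes. [cite: Gottesman1997, §3.5] -/
def logical : (k : ℕ) → ((Fin k → Fin 7) → Bool) → Bool
  | 0, x => x default
  | k + 1, x => par7 fun i => logical k (subBlock x i)

/-- **The normaliser** of the level-`k` Steane sector code (patterns on which every `Z`-type check vanishes): every sub-block is in the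
level-`k` normaliser (inner checks) and the Hamming syndrome of the sub-block classes vanishes (outer checks, written in the inner
logical `Z̄`'s). [cite: Gottesman1997, §3.5] -/
def IsNorm : (k : ℕ) → ((Fin k → Fin 7) → Bool) → Prop
  | 0, _ => True
  | k + 1, x => (∀ i, IsNorm k (subBlock x i)) ∧ hammingSyndrome (fun i => logical k (subBlock x i)) = 0

/-- **The stabilizer** (`X`-part) of the level-`k` Steane sector code: normaliser elements of trivial logical class.
[cite: Gottesman1997, §3.5] -/
def IsStab (k : ℕ) (x : (Fin k → Fin 7) → Bool) : Prop := IsNorm k x ∧ logical k x = false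

/-- Pointwise XOR of two patterns. [cite: Gottesman1997, §3.5] -/
def xorVec {k : ℕ} (x y : (Fin k → Fin 7) → Bool) : (Fin k → Fin 7) → Bool := fun v => x v ^^ y v

/-- Sub-blocks of an XOR. [cite: Gottesman1997, §3.5] -/
theorem subBlock_xorVec {k : ℕ} (x y : (Fin (k + 1) → Fin 7) → Bool) (i : Fin 7) :
    subBlock (xorVec x y) i = xorVec (subBlock x i) (subBlock y i) := rfl

/-- The logical class is additive. [cite: Gottesman1997, §3.5] -/
theorem logical_xorVec : ∀ (k : ℕ) (x y : (Fin k → Fin 7) → Bool), logical k (xorVec x y) = (logical k x ^^ logical k y)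
  | 0, x, y => rfl
  | k + 1, x, y => by
    simp only [logical, subBlock_xorVec, logical_xorVec k]
    exact par7_xor _ _

/-- The normaliser is closed under XOR. [cite: Gottesman1997, §3.5] -/
theorem isNorm_xorVec : ∀ (k : ℕ) (x y : (Fin k → Fin 7) → Bool), IsNorm k x → IsNorm k y → IsNorm k (xorVec x y)
  | 0, _, _, _, _ => trivial
  | k + 1, x, y, hx, hy => by
    simp only [IsNorm] at hx hy ⊢
    refine ⟨fun i => ?_, ?_⟩
    · rw [subBlock_xorVec]; exact isNorm_xorVec k _ _ (hx.1 i) (hy.1 i)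
    · have e : (fun i => logical k (subBlock (xorVec x y) i)) =
          fun i => (logical k (subBlock x i) ^^ logical k (subBlock y i)) := by
        funext i; rw [subBlock_xorVec, logical_xorVec]
      rw [e]; exact hammingSyndrome_xor_eq_zero _ _ hx.2 hy.2

/-- **`X̄_k = X^{⊗7^k}`** (the all-ones pattern) is a normaliser element of odd logical class. [cite: Gottesman1997, §3.5] -/
theorem isNorm_allOnes_and_logical : ∀ k : ℕ, IsNorm k (fun _ : Fin k → Fin 7 => true) ∧ logical k (fun _ => true) = true
  | 0 => ⟨trivial, rfl⟩
  | k + 1 => by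
    obtain ⟨hN, hL⟩ := isNorm_allOnes_and_logical k
    have hsub : ∀ i : Fin 7, subBlock (fun _ : Fin (k + 1) → Fin 7 => true) i = fun _ => true := fun i => rfl
    simp only [IsNorm, logical, hsub, hL]
    exact ⟨⟨fun _ => hN, hammingSyndrome_allOnes⟩, par7_allOnes⟩

/-! ### The hierarchical decoder as an explicit correction -/

/-- **The correction applied by the hierarchical decoder** to the pattern `x`: at level `0` nothing; at level `k+1`, the level-`k`
corrections inside every sub-block, followed by the logical `X̄_k` (all-ones) on the sub-block named by the Hamming syndrome of the
residual sub-block classes. [cite: AliferisGottesmanPreskill2006, §3.2 (the recursive ideal decoder)] -/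
def corr : (k : ℕ) → ((Fin k → Fin 7) → Bool) → ((Fin k → Fin 7) → Bool)
  | 0, _ => fun _ => false
  | k + 1, x => fun w =>
    corr k (subBlock x (w 0)) (Fin.tail w) ^^
      decide ((w 0).val + 1 =
        hammingSyndrome fun i => logical k (xorVec (subBlock x i) (corr k (subBlock x i))))

/-- The residual error after hierarchical decoding: `x + corr k x`. [cite: AliferisGottesmanPreskill2006, §3.2] -/
def res (k : ℕ) (x : (Fin k → Fin 7) → Bool) : (Fin k → Fin 7) → Bool := xorVec x (corr k x)

/-- The sub-blocks of the residual: the inner residual, plus `X̄_k` on the named sub-block. [cite: AliferisGottesmanPreskill2006, §3.2] -/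
theorem subBlock_res (k : ℕ) (x : (Fin (k + 1) → Fin 7) → Bool) (i : Fin 7) :
    subBlock (res (k + 1) x) i =
      xorVec (res k (subBlock x i))
        (fun _ => decide (i.val + 1 = hammingSyndrome fun j => logical k (res k (subBlock x j)))) := by
  funext v
  show (x (Fin.cons i v) ^^ (corr k (subBlock x ((Fin.cons i v : Fin (k + 1) → Fin 7) 0))
      (Fin.tail (Fin.cons i v : Fin (k + 1) → Fin 7)) ^^ _)) = ((x (Fin.cons i v) ^^ corr k (subBlock x i) v) ^^ _)
  rw [← Bool.xor_assoc]
  rfl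

/-- The logical class of a sub-block of the residual. [cite: AliferisGottesmanPreskill2006, §3.2] -/
theorem logical_subBlock_res (k : ℕ) (x : (Fin (k + 1) → Fin 7) → Bool) (i : Fin 7) :
    logical k (subBlock (res (k + 1) x) i) =
      (logical k (res k (subBlock x i)) ^^ decide (i.val + 1 = hammingSyndrome fun j => logical k (res k (subBlock x j)))) := by
  rw [subBlock_res, logical_xorVec]
  congr 1
  cases decide (i.val + 1 = hammingSyndrome fun j => logical k (res k (subBlock x j)))
  · -- the constant-`false` pattern has trivial class
    have : ∀ k, logical k (fun _ : Fin k → Fin 7 => false) = false := by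
      intro k; induction k with
      | zero => rfl
      | succ k ih =>
        have hsub : ∀ i : Fin 7, subBlock (fun _ : Fin (k + 1) → Fin 7 => false) i = fun _ => false := fun i => rfl
        simp only [logical, hsub, ih]; decide
    exact this k
  · exact (isNorm_allOnes_and_logical k).2

/-- **Decoding returns to the normaliser**: every syndrome of the residual vanishes. [cite: AliferisGottesmanPreskill2006, §3.2] -/
theorem isNorm_res : ∀ (k : ℕ) (x : (Fin k → Fin 7) → Bool), IsNorm k (res k x)
  | 0, _ => trivial
  | k + 1, x => by
    refine ⟨fun i => ?_, ?_⟩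
    · rw [subBlock_res]
      refine isNorm_xorVec k _ _ (isNorm_res k _) ?_
      cases decide (i.val + 1 = hammingSyndrome fun j => logical k (res k (subBlock x j)))
      · -- constant `false` is a normaliser element: XOR of all-ones with itself
        have h := isNorm_xorVec k _ _ (isNorm_allOnes_and_logical k).1 (isNorm_allOnes_and_logical k).1
        have e : xorVec (fun _ : Fin k → Fin 7 => true) (fun _ => true) = fun _ => false := by
          funext v; simp [xorVec]
        rwa [e] at h
      · exact (isNorm_allOnes_and_logical k).1
    · have e : (fun i => logical k (subBlock (res (k + 1) x) i)) =
          fun i => (logical k (res k (subBlock x i)) ^^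
            decide (i.val + 1 = hammingSyndrome fun j => logical k (res k (subBlock x j)))) := by
        funext i; exact logical_subBlock_res k x i
      rw [e]
      exact hammingSyndrome_correct _

/-- **The logical class of the residual is the decoder's logical output** `logicalFlip steaneSector`.
[cite: AliferisGottesmanPreskill2006, §3.2] -/
theorem logical_res : ∀ (k : ℕ) (x : (Fin k → Fin 7) → Bool), logical k (res k x) = logicalFlip steaneSector k x
  | 0, x => by
    simp only [logical, res, xorVec, corr, logicalFlip, Bool.xor_false]
    exact congrArg x (Subsingleton.elim _ _)
  | k + 1, x => by
    have ih : ∀ j, logical k (res k (subBlock x j)) = logicalFlip steaneSector k (subBlock x j) := fun j => logical_res k _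
    simp only [logical, logicalFlip]
    rw [steaneSector_eq_par7]
    congr 1
    funext i
    rw [logical_subBlock_res]
    simp only [ih]

/-- **Hierarchical decoding of the level-`k` Steane sector code succeeds — the residual error is a stabilizer — iff no logical flip
survives** (`logicalFlip steaneSector k x = false`). [cite: AliferisGottesmanPreskill2006, §3.2; Gottesman1997, §3.5] -/
theorem isStab_res_iff (k : ℕ) (x : (Fin k → Fin 7) → Bool) :
    IsStab k (res k x) ↔ logicalFlip steaneSector k x = false := by
  unfold IsStab
  rw [logical_res]
  exact ⟨fun h => h.2, fun h => ⟨isNorm_res k x, h⟩⟩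

/-! ### The failure probability of this decoder on this code -/

/-- Decidability of the success event. [cite: AliferisGottesmanPreskill2006, §3.2] -/
instance instDecidableIsNorm : (k : ℕ) → (x : (Fin k → Fin 7) → Bool) → Decidable (IsNorm k x)
  | 0, _ => by unfold IsNorm; infer_instance
  | k + 1, x => by
    unfold IsNorm
    haveI : ∀ y, Decidable (IsNorm k y) := instDecidableIsNorm k
    infer_instance

/-- Decidability of "the residual is a stabilizer". [cite: AliferisGottesmanPreskill2006, §3.2] -/
instance instDecidableIsStab (k : ℕ) (x : (Fin k → Fin 7) → Bool) : Decidable (IsStab k x) := by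
  unfold IsStab; infer_instance

/-- The failure probability of hierarchical decoding of the level-`k` Steane sector code under independent bit flips of rate `p`:
the mass of the patterns whose residual is NOT a stabilizer. [cite: AliferisGottesmanPreskill2006, §3.2] -/
def failProb (p : ℝ) (k : ℕ) : ℝ :=
  ∑ x : (Fin k → Fin 7) → Bool, if IsStab k (res k x) then 0 else wt p k x

/-- **The decoder's failure probability IS `flipProb steaneSector`.** [cite: AliferisGottesmanPreskill2006, §3.2] -/
theorem failProb_eq_flipProb (p : ℝ) (k : ℕ) : failProb p k = flipProb steaneSector p k := by
  unfold failProb flipProb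
  refine Finset.sum_congr rfl fun x _ => ?_
  by_cases h : logicalFlip steaneSector k x = true
  · rw [if_pos h, if_neg (fun hs => by rw [(isStab_res_iff k x).1 hs] at h; exact Bool.false_ne_true h)]
  · rw [if_neg h, if_pos ((isStab_res_iff k x).2 (by simpa using h))]

/-- **Code-capacity threshold `1/21` for one sector of the concatenated Steane code under its hierarchical decoder**: for independent
bit flips of rate `0 ≤ p ≤ 1/21` the residual error fails to be a stabilizer with probability `≤ (1/21)(21p)^{2^k}`.
[cite: AliferisGottesmanPreskill2006, Lemma 2 with §3.2 and §7] -/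
theorem failProb_le {p : ℝ} (hp0 : 0 ≤ p) (hp : p ≤ 1 / 21) (k : ℕ) : failProb p k ≤ 1 / 21 * (21 * p) ^ 2 ^ k := by
  rw [failProb_eq_flipProb]
  exact flipProb_steaneSector_le hp0 hp k

end SteaneSector

end AGP06

end Literature.InformationTheory.QuantumCodes

end
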